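import Summits.AtomisticToContinuum.Crystallization.Theorems.FrustratedLawDichotomyStrainedPatchHomValueT2SoundR

/-!
# (I1) part S — KIT BOOKKEEPING for the joint value leaf (roadmap for `valueLeafT2J_sound`, step 5a): the accumulators of `…HomValueT2KitL` as sums —
# `accLabel` splits off its accumulator, the `passJ` fold is `ok ⇒ every record exists ∧ pen6/pen0 = Σ per-label contributions`, the `passP` fold
# encloses real label sums entrywise (`H`, `g`), array plumbing (`addArr`, `zeroArr`, `map cen/rad` reads), the guards (`kappaShift ⇒ psdTestN`,
# `symOK`, `foldGuard`) and the unpacking of the verdict `valueLeafT2J μ c w = true` into its integer inequality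
# (27623 `(H) HomFloor`, hcp half; decomp-a2c hand-1 g49; critic row 1674 (B) (I1) docket).

No definitions; 0 sorry; standard axioms; no instances / notation / `#eval`.  `--supports stmt-AtomisticToContinuum-27623`.
-/

namespace Summit.AtomisticToContinuum.Crystallization.Theorems.FrustratedLawDichotomyStrainedPatchHomValueT2Kit

open scoped BigOperators
open Finset
open Literature.Analysis.ValidatedNumerics.Numerics
open Summit.AtomisticToContinuum.Crystallization.Theorems.FrustratedLawDichotomyStrainedPatchHomEntryGram (cen rad)
open Summit.AtomisticToContinuum.Crystallization.Theorems.FrustratedLawDichotomyStrainedPatchHomEntryGramHcp (shufFI)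
open Summit.AtomisticToContinuum.Crystallization.Theorems.FrustratedLawDichotomyStrainedPatchHomCurvCentreKit (boxE cenE cenX)
open Summit.AtomisticToContinuum.Crystallization.Theorems.FrustratedLawDichotomyStrainedPatchHomHertzN (psdTestN)

/-! ## §1. Array plumbing -/

/-- Reading `addArr`. [formal bookkeeping] -/
theorem addArr_getD {n i : ℕ} (hi : i < n) (A B : Array FI) : (addArr n A B).getD i fi0 = (A.getD i fi0).add (B.getD i fi0) := by
  unfold addArr; rw [getD_ofFn_lt _ _ hi]

/-- Reading `zeroArr`. [formal bookkeeping] -/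
theorem zeroArr_getD (n i : ℕ) : (zeroArr n).getD i fi0 = fi0 := by
  unfold zeroArr
  simp [Array.getD_eq_getD_getElem?, Array.getElem?_replicate]
  split <;> rfl

/-- `cen fi0 = 0` and `rad fi0 = 0`. [arithmetic] -/
theorem cen_fi0 : cen fi0 = 0 ∧ rad fi0 = 0 := by simp [cen, rad, fi0, FI.ofInt]

/-- Reading a `map cen`. [formal bookkeeping] -/
theorem getD_map_cen (A : Array FI) (k : ℕ) : (A.map cen).getD k 0 = cen (A.getD k fi0) := by
  simp only [Array.getD_eq_getD_getElem?, Array.getElem?_map]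
  cases A[k]? with
  | none => simp [cen_fi0.1]
  | some I => simp

/-- Reading a `map rad`. [formal bookkeeping] -/
theorem getD_map_rad (A : Array FI) (k : ℕ) : (A.map rad).getD k 0 = rad (A.getD k fi0) := by
  simp only [Array.getD_eq_getD_getElem?, Array.getElem?_map]
  cases A[k]? with
  | none => simp [cen_fi0.2]
  | some I => simp

/-- A sum of members is a member of the `FI.add`. [formal bookkeeping] -/
theorem mem_add_of_mem {x y : ℝ} {I J : FI} (hx : FI.mem x I) (hy : FI.mem y J) : FI.mem (x + y) (I.add J) := FI.mem_add hx hy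

/-! ## §2. The guards -/

/-- `kappaShift Hc = some κ` ⟹ the exact PSD test passes at `κ`. [formal bookkeeping] -/
theorem psd_of_kappaShift {Hc : Array ℤ} {κ : ℤ} (h : kappaShift Hc = some κ) : psdTestN 9 (shiftedK Hc κ) = true := by
  unfold kappaShift at h
  split_ifs at h with h0
  · cases h; exact h0
  · have h' := List.find?_some h
    simpa using h'

/-- `symOK Hc = true` ⟹ the folded centre matrix is symmetric. [formal bookkeeping] -/
theorem sym_of_symOK {Hc : Array ℤ} (h : symOK Hc = true) : ∀ k l : Fin 9, get81 Hc k.val l.val = get81 Hc l.val k.val := by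
  unfold symOK at h; exact of_decide_eq_true h

/-- `foldGuard c w = true` ⟹ symmetric centre entries and positive folded half-widths. [formal bookkeeping] -/
theorem of_foldGuard {c w : (Fin 3 × Fin 3) ⊕ Fin 3 → ℤ} (h : foldGuard c w = true) :
    (∀ a b : Fin 3, c (Sum.inl (a, b)) = c (Sum.inl (b, a))) ∧ ∀ p : Fin 9, 0 < foldW w p := by
  unfold foldGuard at h
  simp only [Bool.and_eq_true, decide_eq_true_eq] at h
  obtain ⟨⟨h01, h02, h12⟩, hw⟩ := h
  refine ⟨fun a b => ?_, hw⟩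
  fin_cases a <;> fin_cases b <;> first | rfl | exact h01 | exact h01.symm | exact h02 | exact h02.symm | exact h12 | exact h12.symm

/-! ## §3. `accLabel` splits off its accumulator -/

/-- `accLabel` keeps the guard flag. [formal bookkeeping] -/
theorem accLabel_ok (wgt : ℕ → ℕ → ℕ → ℤ) (blk : ℕ → ℕ → Bool) (wf : Array ℤ) (Rb : DRec) (Hpt : Array FI) (maskX : Bool) (A : AccL) :
    (accLabel wgt blk wf Rb Hpt maskX A).ok = A.ok := by
  unfold accLabel; split_ifs <;> rfl

/-- `accLabel`'s `pen6` is the accumulator's plus the label's own contribution (the value on the zero accumulator). [formal bookkeeping] -/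
theorem accLabel_pen6 (wgt : ℕ → ℕ → ℕ → ℤ) (blk : ℕ → ℕ → Bool) (wf : Array ℤ) (Rb : DRec) (Hpt : Array FI) (maskX : Bool) (A : AccL) :
    (accLabel wgt blk wf Rb Hpt maskX A).pen6 = A.pen6 + (accLabel wgt blk wf Rb Hpt maskX ⟨true, 0, 0⟩).pen6 := by
  unfold accLabel; split_ifs <;> simp

/-- `accLabel`'s `pen0` likewise. [formal bookkeeping] -/
theorem accLabel_pen0 (wgt : ℕ → ℕ → ℕ → ℤ) (blk : ℕ → ℕ → Bool) (wf : Array ℤ) (Rb : DRec) (Hpt : Array FI) (maskX : Bool) (A : AccL) :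
    (accLabel wgt blk wf Rb Hpt maskX A).pen0 = A.pen0 + (accLabel wgt blk wf Rb Hpt maskX ⟨true, 0, 0⟩).pen0 := by
  unfold accLabel; split_ifs <;> simp

/-! ## §4. The `passJ` fold -/

/-- Generic fold invariant for an `AccL`-valued step that keeps/kills the flag and adds per-item contributions. [formal bookkeeping] -/
theorem foldl_accL_spec {β : Type*} (L : List β) (F : AccL → β → AccL) (okb : β → Prop) (c6 c0 : β → ℤ)
    (hF : ∀ A b, (F A b).ok = true → A.ok = true ∧ okb b ∧ (F A b).pen6 = A.pen6 + c6 b ∧ (F A b).pen0 = A.pen0 + c0 b) :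
    ∀ A : AccL, (L.foldl F A).ok = true →
      A.ok = true ∧ (∀ b ∈ L, okb b) ∧ (L.foldl F A).pen6 = A.pen6 + (L.map c6).sum ∧ (L.foldl F A).pen0 = A.pen0 + (L.map c0).sum := by
  induction L with
  | nil => intro A h; simpa using h
  | cons b L ih =>
    intro A h
    rw [List.foldl_cons] at h ⊢
    obtain ⟨hok, hall, h6, h0⟩ := ih (F A b) h
    obtain ⟨hA, hb, e6, e0⟩ := hF A b hok
    refine ⟨hA, ?_, ?_, ?_⟩
    · intro b' hb'
      rcases List.mem_cons.1 hb' with rfl | hmem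
      · exact hb
      · exact hall b' hmem
    · rw [h6, e6, List.map_cons, List.sum_cons]; ring
    · rw [h0, e0, List.map_cons, List.sum_cons]; ring

/-- ★★ **THE `passJ` FOLD**: `ok = true` ⟹ every label of both lists has its box and point records, and `pen6` / `pen0` are the sums of the per-label
contributions of `accLabel` (evaluated on the zero accumulator). [formal bookkeeping] -/
theorem passJ_spec (c w : (Fin 3 × Fin 3) ⊕ Fin 3 → ℤ) (wf : Array ℤ) (LA LB : List (Fin 3 → ℤ)) (h : (passJ c w wf LA LB).ok = true) :
    (∀ b ∈ LA, ∃ Rb Rp, mkDRec 6 (boxE c w) (pA b) = some Rb ∧ mkDRec 6 (cenE c) (pA b) = some Rp) ∧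
    (∀ b ∈ LB, ∃ Rb Rp, mkDRec 9 (boxE c w) (qB (shufFI c w) b) = some Rb ∧ mkDRec 9 (cenE c) (qB (cenX c) b) = some Rp) ∧
    (passJ c w wf LA LB).pen6 =
      (LA.map fun b => match mkDRec 6 (boxE c w) (pA b), mkDRec 6 (cenE c) (pA b) with
        | some Rb, some Rp => (accLabel wJ (fun a b : ℕ => decide (a < 6 ∧ b < 6)) wf Rb (hessOf Rp true) true ⟨true, 0, 0⟩).pen6
        | _, _ => 0).sum +
      (LB.map fun b => match mkDRec 9 (boxE c w) (qB (shufFI c w) b), mkDRec 9 (cenE c) (qB (cenX c) b) with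
        | some Rb, some Rp => (accLabel wJ (fun _ _ : ℕ => true) wf Rb (hessOf Rp false) false ⟨true, 0, 0⟩).pen6
        | _, _ => 0).sum ∧
    (passJ c w wf LA LB).pen0 =
      (LA.map fun b => match mkDRec 6 (boxE c w) (pA b), mkDRec 6 (cenE c) (pA b) with
        | some Rb, some Rp => (accLabel wJ (fun a b : ℕ => decide (a < 6 ∧ b < 6)) wf Rb (hessOf Rp true) true ⟨true, 0, 0⟩).pen0
        | _, _ => 0).sum +
      (LB.map fun b => match mkDRec 9 (boxE c w) (qB (shufFI c w) b), mkDRec 9 (cenE c) (qB (cenX c) b) with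
        | some Rb, some Rp => (accLabel wJ (fun _ _ : ℕ => true) wf Rb (hessOf Rp false) false ⟨true, 0, 0⟩).pen0
        | _, _ => 0).sum := by
  -- the two steps
  set FA : AccL → (Fin 3 → ℤ) → AccL := fun A b =>
    match mkDRec 6 (boxE c w) (pA b), mkDRec 6 (cenE c) (pA b) with
    | some Rb, some Rp => accLabel wJ (fun a b : ℕ => decide (a < 6 ∧ b < 6)) wf Rb (hessOf Rp true) true A
    | _, _ => ⟨false, A.pen6, A.pen0⟩ with hFA
  set FB : AccL → (Fin 3 → ℤ) → AccL := fun A b =>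
    match mkDRec 9 (boxE c w) (qB (shufFI c w) b), mkDRec 9 (cenE c) (qB (cenX c) b) with
    | some Rb, some Rp => accLabel wJ (fun _ _ : ℕ => true) wf Rb (hessOf Rp false) false A
    | _, _ => ⟨false, A.pen6, A.pen0⟩ with hFB
  have hpass : passJ c w wf LA LB = LB.foldl FB (LA.foldl FA ⟨true, 0, 0⟩) := by
    unfold passJ
    simp only [hFA, hFB]
    rfl
  rw [hpass] at h ⊢
  have specA := foldl_accL_spec LA FA (fun b => ∃ Rb Rp, mkDRec 6 (boxE c w) (pA b) = some Rb ∧ mkDRec 6 (cenE c) (pA b) = some Rp)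
    (fun b => match mkDRec 6 (boxE c w) (pA b), mkDRec 6 (cenE c) (pA b) with
        | some Rb, some Rp => (accLabel wJ (fun a b : ℕ => decide (a < 6 ∧ b < 6)) wf Rb (hessOf Rp true) true ⟨true, 0, 0⟩).pen6
        | _, _ => 0)
    (fun b => match mkDRec 6 (boxE c w) (pA b), mkDRec 6 (cenE c) (pA b) with
        | some Rb, some Rp => (accLabel wJ (fun a b : ℕ => decide (a < 6 ∧ b < 6)) wf Rb (hessOf Rp true) true ⟨true, 0, 0⟩).pen0
        | _, _ => 0)
    (fun A b hok => by
      simp only [hFA] at hok ⊢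
      split at hok
      · rename_i Rb Rp h1 h2
        simp only [h1, h2]
        rw [accLabel_ok] at hok
        exact ⟨hok, ⟨Rb, Rp, rfl, rfl⟩, accLabel_pen6 _ _ _ _ _ _ _, accLabel_pen0 _ _ _ _ _ _ _⟩
      · exact absurd hok (by simp))
  have specB := foldl_accL_spec LB FB
    (fun b => ∃ Rb Rp, mkDRec 9 (boxE c w) (qB (shufFI c w) b) = some Rb ∧ mkDRec 9 (cenE c) (qB (cenX c) b) = some Rp)
    (fun b => match mkDRec 9 (boxE c w) (qB (shufFI c w) b), mkDRec 9 (cenE c) (qB (cenX c) b) with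
        | some Rb, some Rp => (accLabel wJ (fun _ _ : ℕ => true) wf Rb (hessOf Rp false) false ⟨true, 0, 0⟩).pen6
        | _, _ => 0)
    (fun b => match mkDRec 9 (boxE c w) (qB (shufFI c w) b), mkDRec 9 (cenE c) (qB (cenX c) b) with
        | some Rb, some Rp => (accLabel wJ (fun _ _ : ℕ => true) wf Rb (hessOf Rp false) false ⟨true, 0, 0⟩).pen0
        | _, _ => 0)
    (fun A b hok => by
      simp only [hFB] at hok ⊢
      split at hok
      · rename_i Rb Rp h1 h2
        simp only [h1, h2]
        rw [accLabel_ok] at hok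
        exact ⟨hok, ⟨Rb, Rp, rfl, rfl⟩, accLabel_pen6 _ _ _ _ _ _ _, accLabel_pen0 _ _ _ _ _ _ _⟩
      · exact absurd hok (by simp))
  obtain ⟨hokA, hallB, h6B, h0B⟩ := specB _ h
  obtain ⟨_, hallA, h6A, h0A⟩ := specA _ hokA
  refine ⟨hallA, hallB, ?_, ?_⟩
  · rw [h6B, h6A]; simp
  · rw [h0B, h0A]; simp

/-! ## §5. The `passP` fold: the point tables enclose real label sums -/

/-- Generic fold invariant for the `PtData` step: flag, records, and ENTRYWISE MEMBERSHIP of a real sum. [formal bookkeeping] -/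
theorem foldl_pt_spec {β : Type*} (L : List β) (mk : β → Option DRec) (maskX : Bool) :
    ∀ A : PtData, (L.foldl (fun A b =>
        match mk b with
        | none => (⟨false, A.H, A.g⟩ : PtData)
        | some R => ⟨A.ok, addArr 81 A.H (hessOf R maskX),
            addArr 9 A.g (Array.ofFn fun a : Fin 9 => if maskX ∧ 6 ≤ a.val then fi0 else R.co.be.mul (R.z a.val))⟩) A).ok = true →
      A.ok = true ∧ (∀ b ∈ L, ∃ R, mk b = some R) ∧
      (∀ n, n < 81 → ∀ (h : β → ℝ) (x : ℝ), (∀ b ∈ L, ∀ R, mk b = some R → FI.mem (h b) ((hessOf R maskX).getD n fi0)) →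
        FI.mem x (A.H.getD n fi0) → FI.mem (x + (L.map h).sum) ((L.foldl (fun A b =>
          match mk b with
          | none => (⟨false, A.H, A.g⟩ : PtData)
          | some R => ⟨A.ok, addArr 81 A.H (hessOf R maskX),
              addArr 9 A.g (Array.ofFn fun a : Fin 9 => if maskX ∧ 6 ≤ a.val then fi0 else R.co.be.mul (R.z a.val))⟩) A).H.getD n fi0)) ∧
      (∀ k, k < 9 → ∀ (h : β → ℝ) (x : ℝ),
        (∀ b ∈ L, ∀ R, mk b = some R → FI.mem (h b) (if maskX ∧ 6 ≤ k then fi0 else R.co.be.mul (R.z k))) →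
        FI.mem x (A.g.getD k fi0) → FI.mem (x + (L.map h).sum) ((L.foldl (fun A b =>
          match mk b with
          | none => (⟨false, A.H, A.g⟩ : PtData)
          | some R => ⟨A.ok, addArr 81 A.H (hessOf R maskX),
              addArr 9 A.g (Array.ofFn fun a : Fin 9 => if maskX ∧ 6 ≤ a.val then fi0 else R.co.be.mul (R.z a.val))⟩) A).g.getD k fi0)) := by
  induction L with
  | nil =>
    intro A h
    refine ⟨by simpa using h, by simp, ?_, ?_⟩
    · intro n hn f x _ hx; simpa using hx
    · intro k hk f x _ hx; simpa using hx
  | cons b L ih =>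
    intro A h
    cases hb : mk b with
    | none =>
      -- the flag dies and never recovers: contradiction with `h`
      simp only [List.foldl_cons, hb] at h
      have := (ih _ h).1
      exact absurd this (by simp)
    | some R =>
      simp only [List.foldl_cons, hb] at h ⊢
      obtain ⟨hok, hall, hH, hg⟩ := ih _ h
      refine ⟨hok, ?_, ?_, ?_⟩
      · intro b' hb'
        rcases List.mem_cons.1 hb' with rfl | hmem
        · exact ⟨R, hb⟩
        · exact hall b' hmem
      · intro n hn f x hmem hx
        rw [List.map_cons, List.sum_cons, ← add_assoc]
        refine hH n hn f (x + f b) (fun b' hb' R' hR' => hmem b' (List.mem_cons_of_mem _ hb') R' hR') ?_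
        show FI.mem (x + f b) ((addArr 81 A.H (hessOf R maskX)).getD n fi0)
        rw [addArr_getD hn]
        exact FI.mem_add hx (hmem b (by simp) R hb)
      · intro k hk f x hmem hx
        rw [List.map_cons, List.sum_cons, ← add_assoc]
        refine hg k hk f (x + f b) (fun b' hb' R' hR' => hmem b' (List.mem_cons_of_mem _ hb') R' hR') ?_
        show FI.mem (x + f b) ((addArr 9 A.g (Array.ofFn fun a : Fin 9 => if maskX ∧ 6 ≤ a.val then fi0 else R.co.be.mul (R.z a.val))).getD k fi0)
        rw [addArr_getD hk, getD_ofFn_lt _ _ hk]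
        exact FI.mem_add hx (hmem b (by simp) R hb)

end Summit.AtomisticToContinuum.Crystallization.Theorems.FrustratedLawDichotomyStrainedPatchHomValueT2Kit
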